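import Mathlib
import HarnessLib
import Summits.Ventures.LatticeQCDFlow.Scoring.ReplicaMeansFixedCount
import Summits.Ventures.LatticeQCDFlow.Scoring.BatchMeansTwoChainFixedBatchCount

/-!
# THE A-vs-B MEAN TEST WITH BETWEEN-REPLICA ERROR BARS AT A FIXED NUMBER OF STREAMS PER ARM:
# `P(|M̄^A − M̄^B| ≤ z √(SE²_{rep,A} + SE²_{rep,B})) → P(R (ḡ − h̄)² ≤ z² (s²(g) + s²(h)))` — Student `t_{2R−2}`

HONEST FRAMING: exact (Metropolis-corrected) sampling algorithms for lattice gauge theory;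
figures of merit are autocorrelation/cost numbers at stated couplings and volumes; no
continuum-physics claim.

Venture `LatticeQCDFlow` (cell pub-lqcd), topic `Scoring`; FANOUT row 4 (`s0-u1-b`, GEN-32).
NEW WORK of the cell, not a published result; no definition is introduced; nothing is cited as a
fact.  Row 4's acceptance sentence "A vs B within `z σ_comb`" compares two codes, each summarised by
`R` independent streams (`R = 8` or `16`) with the error bar `max(Γ error, between-replica SE)`.  For
the between-replica half this file gives the FIXED-`R` calibration: for every kernel with a geometric
sup-norm envelope, every bounded observable with `σ²_f > 0`, two arms of `R ≥ 2` independent runs of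
equal length `n → ∞` from ANY starts (arm laws `⊗_r P_{μ^A_r}`, `⊗_r P_{μ^B_r}`, independent of each
other) and every `z ≥ 0`:
`P(|M̄^A − M̄^B| ≤ z √(SE²_{rep,A} + SE²_{rep,B})) → (N(0,1)^{⊗R} ⊗ N(0,1)^{⊗R}){R (ḡ − h̄)² ≤ z² (s²(g) + s²(h))}`,
the two-sided Student-`t_{2R−2}` probability of `[−z, z]` (named, not evaluated) — by the replica
joint CLT (`Scoring/ReplicaMeansFixedCount.lean`) in each arm, the independent joint limit of the two
arm vectors (`Scoring/IndependentJointLimitVector.lean`), the continuous two-sample Student functional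
(`Scoring/BatchMeansTwoChainFixedBatchCount.lean`) and the portmanteau theorem with the two-sample
Student boundary lemma (`Scoring/GaussianStudentBoundary.lean`).  READING: with `R = 8` streams per
arm the asymptotic one-sigma pass rate of two correct codes is `P(|t_{14}| ≤ 1)`, not `0.683`.
Printed counterpart NAMED ONLY: the two-sample `t` test on replication means (Law–Kelton 2000 §10.2),
nothing cited as a fact.

## Content

* `replica_twoSample_coverage_iff_student` — the event identity for two families of `R` reals;
* **`chain_replicaMeans_twoArm_fixedCount_coverage_of_envelope`** — the theorem above.

NOT CLAIMED: unequal `R` or `n` in the two arms; the Γ half of the printed error bar; the value of the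
Student probability; Doeblin-power restatement (immediate via `exists_geometricEnvelope_of_nHit`).
-/

noncomputable section

namespace Summit.Ventures.LatticeQCDFlow.Scoring

open MeasureTheory ProbabilityTheory Filter Finset Preorder
open scoped ENNReal Topology RealInnerProductSpace

variable {Ω : Type*} [MeasurableSpace Ω]

section Algebra

/-- `R ≥ 2`, `n ≥ 1`, `z ≥ 0`, `V_r = √n (B_r − c)`, `W_r = √n (B'_r − c)`:
`|B̄ − B̄'| ≤ z √(SE²(B) + SE²(B')) ↔ R (V̄ − W̄)² − z² (s²(V) + s²(W)) ≤ 0`. -/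
theorem replica_twoSample_coverage_iff_student {R : ℕ} (B B' : Fin R → ℝ) (c : ℝ) (hR : 2 ≤ R)
    {n : ℕ} (hn : 0 < n) {z : ℝ} (hz : 0 ≤ z) :
    |(∑ r, B r) / (R : ℝ) - (∑ r, B' r) / (R : ℝ)|
        ≤ z * Real.sqrt ((∑ r, (B r - (∑ i, B i) / (R : ℝ)) ^ 2) / ((R : ℝ) * ((R : ℝ) - 1))
          + (∑ r, (B' r - (∑ i, B' i) / (R : ℝ)) ^ 2) / ((R : ℝ) * ((R : ℝ) - 1)))
      ↔ (R : ℝ) * ((∑ i, Real.sqrt n * (B i - c)) / (R : ℝ) - (∑ i, Real.sqrt n * (B' i - c)) / (R : ℝ)) ^ 2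
          - z ^ 2 * (((∑ r, (Real.sqrt n * (B r - c) - (∑ i, Real.sqrt n * (B i - c)) / (R : ℝ)) ^ 2) / ((R : ℝ) - 1))
            + ((∑ r, (Real.sqrt n * (B' r - c) - (∑ i, Real.sqrt n * (B' i - c)) / (R : ℝ)) ^ 2) / ((R : ℝ) - 1))) ≤ 0 := by
  have hnR : (0 : ℝ) < n := Nat.cast_pos.2 hn
  have hRR : (2 : ℝ) ≤ R := by exact_mod_cast hR
  have hR0 : (0 : ℝ) < R := by linarith
  have hsv := replica_sigmaHat_eq_svar B c (R := R) hn
  have hsv' := replica_sigmaHat_eq_svar B' c (R := R) hn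
  have hVbar : ∀ (D : Fin R → ℝ), (∑ i, Real.sqrt n * (D i - c)) / (R : ℝ) = Real.sqrt n * ((∑ r, D r) / (R : ℝ) - c) := by
    intro D
    rw [← Finset.mul_sum, Finset.sum_sub_distrib, Finset.sum_const, Finset.card_univ, Fintype.card_fin,
      nsmul_eq_mul]
    field_simp
  set SE2 := (∑ r, (B r - (∑ i, B i) / (R : ℝ)) ^ 2) / ((R : ℝ) * ((R : ℝ) - 1))
    + (∑ r, (B' r - (∑ i, B' i) / (R : ℝ)) ^ 2) / ((R : ℝ) * ((R : ℝ) - 1)) with hSE2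
  have hden : (0 : ℝ) ≤ (R : ℝ) * ((R : ℝ) - 1) := mul_nonneg hR0.le (by linarith)
  have hSE2nn : 0 ≤ SE2 := add_nonneg (div_nonneg (Finset.sum_nonneg fun r _ => sq_nonneg _) hden)
    (div_nonneg (Finset.sum_nonneg fun r _ => sq_nonneg _) hden)
  rw [← hsv, ← hsv', hVbar B, hVbar B']
  set D := (∑ r, B r) / (R : ℝ) - (∑ r, B' r) / (R : ℝ) with hD
  have hv0 : 0 ≤ z * Real.sqrt SE2 := mul_nonneg hz (Real.sqrt_nonneg _)
  have key : |D| ≤ z * Real.sqrt SE2 ↔ D ^ 2 ≤ (z * Real.sqrt SE2) ^ 2 := by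
    constructor
    · intro h
      have := pow_le_pow_left₀ (abs_nonneg _) h 2
      rwa [sq_abs] at this
    · intro h
      exact abs_le_of_sq_le_sq h hv0
  rw [key, mul_pow, Real.sq_sqrt hSE2nn, Nat.cast_mul]
  have hab : (0 : ℝ) < n * R := mul_pos hnR hR0
  have hsq' : (R : ℝ) * (Real.sqrt n * ((∑ r, B r) / (R : ℝ) - c) - Real.sqrt n * ((∑ r, B' r) / (R : ℝ) - c)) ^ 2
      = (n : ℝ) * R * D ^ 2 := by
    rw [← mul_sub, mul_pow, Real.sq_sqrt hnR.le, hD]; ring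
  rw [hsq']
  constructor
  · intro h
    have h2 := mul_le_mul_of_nonneg_left h hab.le
    linarith [h2]
  · intro h
    by_contra hlt
    push Not at hlt
    have h2 := mul_lt_mul_of_pos_left hlt hab
    linarith [h2]

end Algebra

section Envelope

variable {κ : Kernel Ω Ω} [IsMarkovKernel κ] {π : Measure Ω} [IsProbabilityMeasure π] {A ρ : ℝ}

/-- **THE A-vs-B ONE-SIGMA RULE WITH REPLICA ERROR BARS AT FIXED `R` IS STUDENT-`t_{2R−2}`.**
`π` invariant, envelope `(A, ρ)`, `|f| ≤ C` measurable with `σ²_f > 0`; arms A and B each of `R ≥ 2`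
independent runs of length `n → ∞` from ANY starts, the two arms independent; `z ≥ 0`.  Then
`P(|M̄^A − M̄^B| ≤ z √(SE²_{rep,A} + SE²_{rep,B})) → (N(0,1)^{⊗R} ⊗ N(0,1)^{⊗R}){R (ḡ − h̄)² ≤ z² (s²(g) + s²(h))}`. -/
theorem chain_replicaMeans_twoArm_fixedCount_coverage_of_envelope (hπ : Kernel.Invariant κ π)
    (henv : ∀ (g : Ω → ℝ), Measurable g → ∀ (Cg : ℝ), (∀ x, |g x| ≤ Cg) →
      ∀ (t : ℕ) (x : Ω), |(kop κ)^[t] g x - ∫ y, g y ∂π| ≤ 2 * Cg * (A * ρ ^ t))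
    (hA : 0 ≤ A) (hρ0 : 0 ≤ ρ) (hρ1 : ρ < 1)
    {f : Ω → ℝ} (hf : Measurable f) {C : ℝ} (hC : ∀ x, |f x| ≤ C)
    (hσ : 0 < ((∫ y, (f y - ∫ z, f z ∂(π)) ^ 2 ∂(π)) + 2 * ∑' k, ∫ y, (f y - ∫ z, f z ∂(π)) * (kop (κ))^[k + 1] (fun y => f y - ∫ z, f z ∂(π)) y ∂(π)))
    {R : ℕ} (hR : 2 ≤ R) (μA μB : Fin R → Measure Ω) [∀ r, IsProbabilityMeasure (μA r)]
    [∀ r, IsProbabilityMeasure (μB r)] {z : ℝ} (hz : 0 ≤ z)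
    [∀ r, IsProbabilityMeasure (Kernel.trajMeasure (X := fun _ : ℕ => Ω) (μA r)
          (fun n : ℕ => κ.comap (fun h' : (i : ↥(Finset.Iic n)) → Ω => h' ⟨n, Finset.mem_Iic.2 le_rfl⟩)
            (measurable_pi_apply _)))]
    [∀ r, IsProbabilityMeasure (Kernel.trajMeasure (X := fun _ : ℕ => Ω) (μB r)
          (fun n : ℕ => κ.comap (fun h' : (i : ↥(Finset.Iic n)) → Ω => h' ⟨n, Finset.mem_Iic.2 le_rfl⟩)
            (measurable_pi_apply _)))] :
    Tendsto (fun n => ((Measure.pi fun r => (Kernel.trajMeasure (X := fun _ : ℕ => Ω) (μA r)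
          (fun n : ℕ => κ.comap (fun h' : (i : ↥(Finset.Iic n)) → Ω => h' ⟨n, Finset.mem_Iic.2 le_rfl⟩)
            (measurable_pi_apply _)))).prod
        (Measure.pi fun r => (Kernel.trajMeasure (X := fun _ : ℕ => Ω) (μB r)
          (fun n : ℕ => κ.comap (fun h' : (i : ↥(Finset.Iic n)) → Ω => h' ⟨n, Finset.mem_Iic.2 le_rfl⟩)
            (measurable_pi_apply _))))).real
        {ω : (Fin R → (ℕ → Ω)) × (Fin R → (ℕ → Ω)) |
          |(∑ r, (∑ t ∈ Finset.range n, f (ω.1 r t)) / n) / (R : ℝ)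
              - (∑ r, (∑ t ∈ Finset.range n, f (ω.2 r t)) / n) / (R : ℝ)|
            ≤ z * Real.sqrt ((∑ r, ((∑ t ∈ Finset.range n, f (ω.1 r t)) / n
                - (∑ i, (∑ t ∈ Finset.range n, f (ω.1 i t)) / n) / (R : ℝ)) ^ 2) / ((R : ℝ) * ((R : ℝ) - 1))
              + (∑ r, ((∑ t ∈ Finset.range n, f (ω.2 r t)) / n
                - (∑ i, (∑ t ∈ Finset.range n, f (ω.2 i t)) / n) / (R : ℝ)) ^ 2) / ((R : ℝ) * ((R : ℝ) - 1)))})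
      atTop (𝓝 (((Measure.pi fun _ : Fin R => gaussianReal 0 1).prod (Measure.pi fun _ : Fin R => gaussianReal 0 1)).real
        {p : (Fin R → ℝ) × (Fin R → ℝ) | (R : ℝ) * ((∑ i, p.1 i) / (R : ℝ) - (∑ i, p.2 i) / (R : ℝ)) ^ 2
            ≤ z ^ 2 * (((∑ j, (p.1 j - (∑ i, p.1 i) / (R : ℝ)) ^ 2) / ((R : ℝ) - 1))
              + ((∑ j, (p.2 j - (∑ i, p.2 i) / (R : ℝ)) ^ 2) / ((R : ℝ) - 1)))})) := by
  obtain ⟨k, rfl⟩ := Nat.exists_eq_succ_of_ne_zero (show R ≠ 0 by omega)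
  have hk : 1 ≤ k := by omega
  set σ2 : ℝ := ((∫ y, (f y - ∫ z, f z ∂(π)) ^ 2 ∂(π)) + 2 * ∑' k, ∫ y, (f y - ∫ z, f z ∂(π)) * (kop (κ))^[k + 1] (fun y => f y - ∫ z, f z ∂(π)) y ∂(π)) with hσ2
  have hσ2nn : 0 ≤ σ2 := hσ.le
  set Pg : Measure (Fin (k + 1) → ℝ) := Measure.pi fun _ : Fin (k + 1) => gaussianReal 0 1 with hPg
  -- the two arm limits live on `(Fin (k+1) → ℝ) × (Fin (k+1) → ℝ)` with law `Pg ⊗ Pg`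
  have hJA := chain_replicaMeans_joint_clt_of_envelope hπ henv hA hρ0 hρ1 hf hC μA
  have hJB := chain_replicaMeans_joint_clt_of_envelope hπ henv hA hρ0 hρ1 hf hC μB
  -- transport the limit variables to the product space via the coordinate projections
  have hL : Measurable fun g : Fin (k + 1) → ℝ =>
      (WithLp.toLp 2 (fun r : Fin (k + 1) => Real.sqrt σ2 * g r) : EuclideanSpace ℝ (Fin (k + 1))) :=
    (WithLp.measurable_toLp 2 _).comp (measurable_pi_lambda _ fun r => (measurable_pi_apply r).const_mul _)
  have hfst : MeasurePreserving (Prod.fst : (Fin (k + 1) → ℝ) × (Fin (k + 1) → ℝ) → _) (Pg.prod Pg) Pg :=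
    measurePreserving_fst
  have hsnd : MeasurePreserving (Prod.snd : (Fin (k + 1) → ℝ) × (Fin (k + 1) → ℝ) → _) (Pg.prod Pg) Pg :=
    measurePreserving_snd
  have hJA' : TendstoInDistribution (fun (n : ℕ) (ω : Fin (k + 1) → (ℕ → Ω)) =>
        (WithLp.toLp 2 (fun r : Fin (k + 1) => (∑ t ∈ Finset.range n, (f (ω r t) - ∫ z, f z ∂π)) / Real.sqrt n)
          : EuclideanSpace ℝ (Fin (k + 1))))
      atTop (fun p : (Fin (k + 1) → ℝ) × (Fin (k + 1) → ℝ) =>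
        (WithLp.toLp 2 (fun r : Fin (k + 1) => Real.sqrt σ2 * p.1 r) : EuclideanSpace ℝ (Fin (k + 1))))
      (fun _ => Measure.pi fun r => (Kernel.trajMeasure (X := fun _ : ℕ => Ω) (μA r)
          (fun n : ℕ => κ.comap (fun h' : (i : ↥(Finset.Iic n)) → Ω => h' ⟨n, Finset.mem_Iic.2 le_rfl⟩)
            (measurable_pi_apply _))))
      (Pg.prod Pg) := by
    refine ⟨hJA.forall_aemeasurable, (hL.comp measurable_fst).aemeasurable, ?_⟩
    have e : (Pg.prod Pg).map (fun p : (Fin (k + 1) → ℝ) × (Fin (k + 1) → ℝ) =>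
        (WithLp.toLp 2 (fun r : Fin (k + 1) => Real.sqrt σ2 * p.1 r) : EuclideanSpace ℝ (Fin (k + 1))))
        = Pg.map (fun g : Fin (k + 1) → ℝ =>
          (WithLp.toLp 2 (fun r : Fin (k + 1) => Real.sqrt σ2 * g r) : EuclideanSpace ℝ (Fin (k + 1)))) := by
      rw [show (fun p : (Fin (k + 1) → ℝ) × (Fin (k + 1) → ℝ) =>
          (WithLp.toLp 2 (fun r : Fin (k + 1) => Real.sqrt σ2 * p.1 r) : EuclideanSpace ℝ (Fin (k + 1))))
          = (fun g : Fin (k + 1) → ℝ => (WithLp.toLp 2 (fun r : Fin (k + 1) => Real.sqrt σ2 * g r)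
            : EuclideanSpace ℝ (Fin (k + 1)))) ∘ Prod.fst from rfl,
        ← Measure.map_map hL measurable_fst, hfst.map_eq]
    simp_rw [e]
    exact hJA.tendsto
  have hJB' : TendstoInDistribution (fun (n : ℕ) (ω : Fin (k + 1) → (ℕ → Ω)) =>
        (WithLp.toLp 2 (fun r : Fin (k + 1) => (∑ t ∈ Finset.range n, (f (ω r t) - ∫ z, f z ∂π)) / Real.sqrt n)
          : EuclideanSpace ℝ (Fin (k + 1))))
      atTop (fun p : (Fin (k + 1) → ℝ) × (Fin (k + 1) → ℝ) =>
        (WithLp.toLp 2 (fun r : Fin (k + 1) => Real.sqrt σ2 * p.2 r) : EuclideanSpace ℝ (Fin (k + 1))))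
      (fun _ => Measure.pi fun r => (Kernel.trajMeasure (X := fun _ : ℕ => Ω) (μB r)
          (fun n : ℕ => κ.comap (fun h' : (i : ↥(Finset.Iic n)) → Ω => h' ⟨n, Finset.mem_Iic.2 le_rfl⟩)
            (measurable_pi_apply _))))
      (Pg.prod Pg) := by
    refine ⟨hJB.forall_aemeasurable, (hL.comp measurable_snd).aemeasurable, ?_⟩
    have e : (Pg.prod Pg).map (fun p : (Fin (k + 1) → ℝ) × (Fin (k + 1) → ℝ) =>
        (WithLp.toLp 2 (fun r : Fin (k + 1) => Real.sqrt σ2 * p.2 r) : EuclideanSpace ℝ (Fin (k + 1))))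
        = Pg.map (fun g : Fin (k + 1) → ℝ =>
          (WithLp.toLp 2 (fun r : Fin (k + 1) => Real.sqrt σ2 * g r) : EuclideanSpace ℝ (Fin (k + 1)))) := by
      rw [show (fun p : (Fin (k + 1) → ℝ) × (Fin (k + 1) → ℝ) =>
          (WithLp.toLp 2 (fun r : Fin (k + 1) => Real.sqrt σ2 * p.2 r) : EuclideanSpace ℝ (Fin (k + 1))))
          = (fun g : Fin (k + 1) → ℝ => (WithLp.toLp 2 (fun r : Fin (k + 1) => Real.sqrt σ2 * g r)
            : EuclideanSpace ℝ (Fin (k + 1)))) ∘ Prod.snd from rfl,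
        ← Measure.map_map hL measurable_snd, hsnd.map_eq]
    simp_rw [e]
    exact hJB.tendsto
  have hind : IndepFun
      (fun p : (Fin (k + 1) → ℝ) × (Fin (k + 1) → ℝ) =>
        (WithLp.toLp 2 (fun r : Fin (k + 1) => Real.sqrt σ2 * p.1 r) : EuclideanSpace ℝ (Fin (k + 1))))
      (fun p : (Fin (k + 1) → ℝ) × (Fin (k + 1) → ℝ) =>
        (WithLp.toLp 2 (fun r : Fin (k + 1) => Real.sqrt σ2 * p.2 r) : EuclideanSpace ℝ (Fin (k + 1))))
      (Pg.prod Pg) :=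
    (indepFun_prod₀ (μ := Pg) (ν := Pg) aemeasurable_id aemeasurable_id).comp hL hL
  have hpair := CardConsistency.tendstoInDistribution_prodMk_twoCodes_vector hJA' hJB' hind
  -- the two-sample Student functional and its limit `σ² · H₀`
  have hcont := hpair.continuous_comp (continuous_euclidean_twoSample_student (k + 1) z)
  set H₀ : (Fin (k + 1) → ℝ) × (Fin (k + 1) → ℝ) → ℝ := fun p =>
    ((k + 1 : ℕ) : ℝ) * ((∑ i, p.1 i) / ((k + 1 : ℕ) : ℝ) - (∑ i, p.2 i) / ((k + 1 : ℕ) : ℝ)) ^ 2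
      - z ^ 2 * (((∑ j, (p.1 j - (∑ i, p.1 i) / ((k + 1 : ℕ) : ℝ)) ^ 2) / (((k + 1 : ℕ) : ℝ) - 1))
        + ((∑ j, (p.2 j - (∑ i, p.2 i) / ((k + 1 : ℕ) : ℝ)) ^ 2) / (((k + 1 : ℕ) : ℝ) - 1))) with hH₀
  have hH₀m : Measurable H₀ := by
    simp only [hH₀]
    fun_prop
  have hlim : ∀ p : (Fin (k + 1) → ℝ) × (Fin (k + 1) → ℝ),
      ((fun q : EuclideanSpace ℝ (Fin (k + 1)) × EuclideanSpace ℝ (Fin (k + 1)) =>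
      ((k + 1 : ℕ) : ℝ) * ((∑ i, q.1 i) / ((k + 1 : ℕ) : ℝ) - (∑ i, q.2 i) / ((k + 1 : ℕ) : ℝ)) ^ 2
        - z ^ 2 * (((∑ j, (q.1 j - (∑ i, q.1 i) / ((k + 1 : ℕ) : ℝ)) ^ 2) / (((k + 1 : ℕ) : ℝ) - 1))
          + ((∑ j, (q.2 j - (∑ i, q.2 i) / ((k + 1 : ℕ) : ℝ)) ^ 2) / (((k + 1 : ℕ) : ℝ) - 1)))) ∘
      (fun p : (Fin (k + 1) → ℝ) × (Fin (k + 1) → ℝ) =>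
        ((WithLp.toLp 2 (fun r : Fin (k + 1) => Real.sqrt σ2 * p.1 r) : EuclideanSpace ℝ (Fin (k + 1))),
         (WithLp.toLp 2 (fun r : Fin (k + 1) => Real.sqrt σ2 * p.2 r) : EuclideanSpace ℝ (Fin (k + 1)))))) p
      = σ2 * H₀ p := by
    intro p
    simp only [Function.comp, hH₀]
    have e1 : ∀ (g : Fin (k + 1) → ℝ), ∑ i, Real.sqrt σ2 * g i = Real.sqrt σ2 * ∑ i, g i :=
      fun g => by rw [Finset.mul_sum]
    have e2 : ∀ (g : Fin (k + 1) → ℝ) (j : Fin (k + 1)),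
        Real.sqrt σ2 * g j - Real.sqrt σ2 * (∑ i, g i) / ((k + 1 : ℕ) : ℝ)
          = Real.sqrt σ2 * (g j - (∑ i, g i) / ((k + 1 : ℕ) : ℝ)) := fun g j => by ring
    rw [e1, e1]
    simp_rw [e2, mul_pow, Real.sq_sqrt hσ2nn, ← Finset.mul_sum]
    have e3 : ∀ (g : Fin (k + 1) → ℝ), (Real.sqrt σ2 * ∑ i, g i) / ((k + 1 : ℕ) : ℝ)
        = Real.sqrt σ2 * ((∑ i, g i) / ((k + 1 : ℕ) : ℝ)) := fun g => by ring
    rw [e3, e3, ← mul_sub, mul_pow, Real.sq_sqrt hσ2nn]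
    ring
  have hclt := hcont.congr (fun n => ae_of_all _ fun x => rfl) (ae_of_all _ hlim)
  have hZm : AEMeasurable (fun p : (Fin (k + 1) → ℝ) × (Fin (k + 1) → ℝ) => σ2 * H₀ p) (Pg.prod Pg) :=
    (hH₀m.const_mul σ2).aemeasurable
  have hfr : ((Pg.prod Pg).map (fun p : (Fin (k + 1) → ℝ) × (Fin (k + 1) → ℝ) => σ2 * H₀ p))
      (frontier (Set.Iic (0 : ℝ))) = 0 := by
    rw [frontier_Iic, Measure.map_apply_of_aemeasurable hZm (measurableSet_singleton 0)]
    have hset : (fun p : (Fin (k + 1) → ℝ) × (Fin (k + 1) → ℝ) => σ2 * H₀ p) ⁻¹' {0} = {p | H₀ p = 0} := by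
      ext p
      simp only [Set.mem_preimage, Set.mem_singleton_iff, Set.mem_setOf_eq, mul_eq_zero, hσ.ne', false_or]
    rw [hset]
    exact pi_gaussianReal_twoSample_studentBoundary_eq_zero k hk z
  have key := CardConsistency.tendsto_measureReal_preimage_of_tendstoInDistribution hclt measurableSet_Iic hfr
  have hlimset : (Pg.prod Pg).real ((fun p : (Fin (k + 1) → ℝ) × (Fin (k + 1) → ℝ) => σ2 * H₀ p) ⁻¹' Set.Iic 0)
      = (Pg.prod Pg).real {p : (Fin (k + 1) → ℝ) × (Fin (k + 1) → ℝ) |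
          ((k + 1 : ℕ) : ℝ) * ((∑ i, p.1 i) / ((k + 1 : ℕ) : ℝ) - (∑ i, p.2 i) / ((k + 1 : ℕ) : ℝ)) ^ 2
            ≤ z ^ 2 * (((∑ j, (p.1 j - (∑ i, p.1 i) / ((k + 1 : ℕ) : ℝ)) ^ 2) / (((k + 1 : ℕ) : ℝ) - 1))
              + ((∑ j, (p.2 j - (∑ i, p.2 i) / ((k + 1 : ℕ) : ℝ)) ^ 2) / (((k + 1 : ℕ) : ℝ) - 1)))} := by
    congr 1
    ext p
    simp only [Set.mem_preimage, Set.mem_Iic, Set.mem_setOf_eq, hH₀]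
    constructor
    · intro h; nlinarith [hσ]
    · intro h; nlinarith [hσ]
  rw [hlimset] at key
  refine key.congr' ?_
  filter_upwards [Filter.eventually_gt_atTop 0] with n hn
  congr 1
  ext ω
  simp only [Set.mem_preimage, Set.mem_Iic, Set.mem_setOf_eq, Function.comp]
  have hnR : (0 : ℝ) < n := Nat.cast_pos.2 hn
  have hsn : 0 < Real.sqrt n := Real.sqrt_pos.2 hnR
  have hV : ∀ (x : Fin (k + 1) → (ℕ → Ω)) (r : Fin (k + 1)),
      (∑ t ∈ Finset.range n, (f (x r t) - ∫ z, f z ∂π)) / Real.sqrt n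
      = Real.sqrt n * ((∑ t ∈ Finset.range n, f (x r t)) / n - ∫ z, f z ∂π) := by
    intro x r
    have hsq : Real.sqrt (n : ℝ) * Real.sqrt n = n := Real.mul_self_sqrt hnR.le
    rw [div_eq_iff hsn.ne', Finset.sum_sub_distrib, Finset.sum_const, Finset.card_range, nsmul_eq_mul]
    have : Real.sqrt (n : ℝ) * ((∑ t ∈ Finset.range n, f (x r t)) / n - ∫ z, f z ∂π) * Real.sqrt n
        = (Real.sqrt (n : ℝ) * Real.sqrt n) * ((∑ t ∈ Finset.range n, f (x r t)) / n - ∫ z, f z ∂π) := by ring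
    rw [this, hsq]
    field_simp
  simp only [hV]
  exact (replica_twoSample_coverage_iff_student (fun r => (∑ t ∈ Finset.range n, f (ω.1 r t)) / n)
    (fun r => (∑ t ∈ Finset.range n, f (ω.2 r t)) / n) (∫ z, f z ∂π) hR hn hz).symm

end Envelope

end Summit.Ventures.LatticeQCDFlow.Scoring

end
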